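import Literature.MathematicalPhysics.QuantumFieldTheory.Balaban1983to89.B9Eq349ConjugatedQTowerLettersTwoBackgroundsReadings
import Literature.MathematicalPhysics.QuantumFieldTheory.Balaban1983to89.B9Eq349ConjugatedQTowerLettersCompanion

/-!
# `Balaban1983to89.B9Eq349ConjugatedQTowerLettersTwoBackgroundsCompanion` — T. Bałaban, *Propagators for lattice gauge theories in a background field*,
# Commun. Math. Phys. **99** (1985) 389–434 [Balaban1985BackgroundPropagators] (3.15)–(3.19) p. 393, (3.26) p. 395, (3.49) p. 399, (3.101)–(3.103) p. 414:
# **THE CONJUGATED TWO-BACKGROUND TOWER `Q_k` LETTERS IN THE COMPANION SHAPE** — for ONE fine weight `χ` on `T_{L^{n+1}m}` with bond increments `≤ ι`, ONE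
# big-block companion `χ′` on `T_m` (`|χ′(y) − χ(x)| ≤ ℓ′` for `x` in the big block of `y`), the multipliers `M_B` (fine bonds) ∕ `M_F` (coarse bonds) and
# `κ` in the windows `‖κ‖(3ℓ′ + L^{n+1}ι) ≤ 1`, `‖κ‖·2dL^nι ≤ 1`:
# `‖exp(κ•M_F)(Q_k(U)(exp(κ•(−M_B))f)) − exp(κ•M_F)(Q_k(V)(exp(κ•(−M_B))f))‖ ≤ M_φ′M_φ·√(c₁∕(c₀L^{(n+1)d}))·P′_{n+1}·(T̃_{n+1} − 1)·‖f‖` and the adjoint twin,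
# with the per-level readings `r_0 = 3ℓ′ + L^{n+1}ι`, `r_j = 2dL^{n+1−j}ι` SUBSTITUTED for `ℓ′_j` in `P′`, `T̃` — the `δ_Q` ∧ `δ_Q′` conjuncts of the two-background
# bundle `hT2'` of this lineage's `B9Eq326DeltaABlockDecayTowerTwoBackgroundsCurv.norm_block_G1k_sub_G1k_le_lipschitz_curv`, as a theorem

statement-level skeleton of published theorems with citation tags; proofs where landed; nothing here is a claim about the Yang–Mills mass gap

PDF held: `paper:balaban1985-cmp99-background-propagators` (journal page = PDF page + 388): p. 393 (3.15)–(3.19), p. 395 (3.26), p. 399 (3.49), p. 414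
(3.101)–(3.103) — through the held text and the verbatim quotations of the suppliers.

CITATION HEADER (lean-in-tree rule 2026-08-18).  Audit cell `pub-balaban`, sub-cell `t4`, NE9 crux team (2): LEAF PROVER 01
(`b2b-balaban-t4-ne9-formalise-leaf-01` gen 90), file 4 of the batch «the `δ_Q` ∕ `δ_Q′` conjuncts of the N52 road (α) END».  WHY: the sibling
`B9Eq349ConjugatedQTowerLettersTwoBackgroundsReadings` DISPLAYS per-level cut-offs `χ_j` and readings `ℓ′_j`; the consumer (`hT2'` of I-13) speaks of ONE
physical cut-off pair and the operator exponentials.  The substitution is the NE9 OWNER lineage gen 94's (`B9Eq349ConjugatedQTowerLettersCompanion`: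
`readings_nonneg`, `readings_window`, `family_readings` over `B9Eq349TowerCutoffReadings.exists_levelEmbedding` — TEMPLATE AND LEMMAS CREDITED, used BY
NAME; the pointwise action of `exp(κ•M)` is `B9Eq3101ExpPointwiseMultiplier`).

WHAT IS PROVED (sorry-free; proof lane — no `def`; [folklore] composition BY NAME).  Data: the sibling's two-background tower letters (`U`, `V` on
`T_{L^{n+1}m}`, `α_j` ∕ `α′_j ≤ 1∕128`, common `ε_j`, multiplicative closeness `δ_j ≤ 1∕(12288N)`), fibre `φ` (`M_φ`, `M_φ′`), weights `c₀`, `c₁`, the cut-off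
pair `χ`, `χ′` with `ι`, `ℓ′`, the multipliers `M_B`, `M_F` by their pointwise action, the two windows.
* **`norm_expConj_QkW_sub_expConj_QkW_le`** (the `δ_Q` letter displayed in the title), **`norm_expConj_adjoint_QkW_sub_expConj_adjoint_QkW_le`** (`δ_Q′`:
  `‖exp(κ•M_B)(Q_k(U)†(exp(κ•(−M_F))g)) − exp(κ•M_B)(Q_k(V)†(exp(κ•(−M_F))g))‖ ≤` the same `× ‖g‖`), **`expConj_Qk_letters_twoBackgrounds`** (both, on the
  circle `‖κ‖ = r` with the windows read at `r` — the `hT2'` shape).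
MODEL ∕ DECLARED READINGS.  Those of the siblings; `W` finite-dimensional (the adjoints).
HONEST SCOPE.  [folklore] composition; crude constants (the product difference with the readings substituted — bounding it by a closed `N·r·δ` is the
consumer's arithmetic); at the consumer `ι = ℓη` so `L^{n+1}ι = ℓ` on (3.16); nothing of [B9] Thm 3.1∕3.3∕3.11 or [B7] Prop. 2∕7 asserted, valued or
discharged; «NE9 ⇐ the named binders»; NE9 NOT PRINTED ∕ NOT PROVED; NOT summit progress (cell pub-balaban: row NE9 WALLED ON A MODEL (O-NE9-1; #5 UNRULED);
spine PROVED 0∕9; rung (B)+1 on a finite T⁴ — NOT infinite volume, NOT mass gap, NOT BetaPertH, NOT Clay; HONEST DEPENDENCY: continuum YM on T⁴ ⇐ BetaPertH ∧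
nine spine estimates (0/9 proved); BetaPertH ⇐ (D1) ∧ (D4) ∧ CAP+tail; G-an2-4 gates asym, D1 and NE2/3/4).  NEW file; nothing modified.  Net new unproved
facts: 0.
-/

noncomputable section

set_option autoImplicit false

open scoped InnerProductSpace ComplexConjugate BigOperators
open NormedSpace

namespace Literature.MathematicalPhysics.QuantumFieldTheory.Balaban1983to89.B9Eq349ConjugatedQTowerLettersTwoBackgroundsCompanion

open B4Sect5Torus (TSite)
open B9SectCLatticeCarrier (Bond bpos btgt shift)
open B7Prop1Explicit (U1 Wcx boxVec)
open B9Eq319QprimeTorus (fineP blockCoord)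
open B9Eq311L2Pairing (WL2)
open B11Eq103H1Complex (BondL2K)
open B9Eq315QTorus (perCfg cornerSite)
open B9Eq315QTower (towerP towerP_apply UlevOf)
open B9Eq326OperatorTower (QkW)
open B9Eq316TowerFlatIsOneStep (siteCast towerP_eq_fineP_pow)
open B9Eq349TowerCutoffReadings (exists_levelEmbedding)
open B9Eq349ConjugatedQTowerLettersCompanion (readings_nonneg readings_window family_readings)
open B9Eq349ConjugatedQTowerLettersTwoBackgroundsReadings (norm_conj_QkW_sub_conj_QkW_le norm_conj_adjoint_QkW_sub_conj_adjoint_QkW_le)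
open B9Eq3101ExpPointwiseMultiplier (equiv_exp_smul_apply_complex equiv_exp_smul_neg_apply_complex)

variable {d : ℕ} (L : ℕ) [NeZero L]
  {𝔸 : Type*} [NormedRing 𝔸] [NormOneClass 𝔸] [NormedAlgebra ℂ 𝔸] [CompleteSpace 𝔸]
  (m : Fin d → ℕ) [∀ i, NeZero (m i)] (n : ℕ) (hL : 1 ≤ L) (hm : ∀ i, 1 ≤ m i)
  {W : Type*} [NormedAddCommGroup W] [InnerProductSpace ℂ W] [FiniteDimensional ℂ W] (φ : W ≃ₗ[ℂ] 𝔸) {Mφ Mφ' : ℝ} (hMφ : 0 ≤ Mφ) (hMφ' : 0 ≤ Mφ')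
  (hφ : ∀ w, ‖φ w‖ ≤ Mφ * ‖w‖) (hφ' : ∀ X, ‖φ.symm X‖ ≤ Mφ' * ‖X‖) {c₀ c₁ : ℝ} [Fact (0 < c₀)] [Fact (0 < c₁)]
  (U V : Bond d (towerP L m (n + 1)) → 𝔸ˣ) (α : ℕ → ℝ) (hα1 : ∀ j, α j ≤ 1 / 64)
  (hU1 : ∀ (j : ℕ) (x : B7Prop1Explicit.Site d) (k : Fin d), perCfg (towerP L m (j + 1)) (UlevOf L m (n + 1) U j) x k ∈ U1 𝔸)
  (hreg : ∀ (j : ℕ) (y : TSite d (towerP L m j)) (k : Fin d) (r : Fin d → Fin L),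
    ‖((Wcx L (perCfg (towerP L m (j + 1)) (UlevOf L m (n + 1) U j)) (cornerSite L y) k (boxVec L r) : 𝔸ˣ) : 𝔸) - 1‖ ≤ α j)
  (α' : ℕ → ℝ) (hα1' : ∀ j, α' j ≤ 1 / 64)
  (hV1 : ∀ (j : ℕ) (x : B7Prop1Explicit.Site d) (k : Fin d), perCfg (towerP L m (j + 1)) (UlevOf L m (n + 1) V j) x k ∈ U1 𝔸)
  (hregV : ∀ (j : ℕ) (y : TSite d (towerP L m j)) (k : Fin d) (r : Fin d → Fin L),
    ‖((Wcx L (perCfg (towerP L m (j + 1)) (UlevOf L m (n + 1) V j)) (cornerSite L y) k (boxVec L r) : 𝔸ˣ) : 𝔸) - 1‖ ≤ α' j)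
  (hα128 : ∀ j, α' j ≤ 1 / 128)
  (εU : ℕ → ℝ) (hεU : ∀ j, 0 ≤ εU j)
  (hUε : ∀ (j : ℕ) (b : Bond d (towerP L m (j + 1))), ‖(UlevOf L m (n + 1) U j b : 𝔸) - 1‖ ≤ εU j)
  (hVε : ∀ (j : ℕ) (b : Bond d (towerP L m (j + 1))), ‖(UlevOf L m (n + 1) V j b : 𝔸) - 1‖ ≤ εU j)
  (δUV : ℕ → ℝ) (hδUV : ∀ j, 0 ≤ δUV j) (hδmax : ∀ j, δUV j ≤ 1 / (12288 * ((2 * (d * L) + L + L : ℕ) : ℝ)))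
  (hUVδ : ∀ (j : ℕ) (b : Bond d (towerP L m (j + 1))),
    ‖(UlevOf L m (n + 1) U j b : 𝔸) * (((UlevOf L m (n + 1) V j b)⁻¹ : 𝔸ˣ) : 𝔸) - 1‖ ≤ δUV j)
  {χ : TSite d (towerP L m (n + 1)) → ℝ} {χ' : TSite d m → ℝ} {ι ℓ' : ℝ} (hι : 0 ≤ ι) (hℓ' : 0 ≤ ℓ')
  (hχ : ∀ b : Bond d (towerP L m (n + 1)), |χ (bpos b) - χ (btgt b)| ≤ ι)
  (hχ' : ∀ (y : TSite d m) (x : TSite d (towerP L m (n + 1))),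
    siteCast (towerP_eq_fineP_pow L m (n + 1)) x ∈ B9Eq319QprimeTorus.blockOf (L ^ (n + 1)) m y → |χ' y - χ x| ≤ ℓ')
  {MB : BondL2K ℂ d (towerP L m (n + 1)) c₀ W →L[ℂ] BondL2K ℂ d (towerP L m (n + 1)) c₀ W}
  (hMB : ∀ (g : BondL2K ℂ d (towerP L m (n + 1)) c₀ W) (b : Bond d (towerP L m (n + 1))),
    WL2.equiv ℂ (fun _ : Bond d (towerP L m (n + 1)) => c₀) W (MB g) b =
      (χ (bpos b) : ℂ) • WL2.equiv ℂ (fun _ : Bond d (towerP L m (n + 1)) => c₀) W g b)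
  {MF : BondL2K ℂ d m c₁ W →L[ℂ] BondL2K ℂ d m c₁ W}
  (hMF : ∀ (g : BondL2K ℂ d m c₁ W) (c : Bond d m),
    WL2.equiv ℂ (fun _ : Bond d m => c₁) W (MF g) c = (χ' (bpos c) : ℂ) • WL2.equiv ℂ (fun _ : Bond d m => c₁) W g c)

section Letters

variable {κ : ℂ} (hwin0 : ‖κ‖ * (3 * ℓ' + (L : ℝ) ^ (n + 1) * ι) ≤ 1) (hwin1 : ‖κ‖ * (2 * d * (L : ℝ) ^ n * ι) ≤ 1)

include hL hm hMφ hMφ' hφ hφ' hα128 hεU hUε hVε hδUV hδmax hUVδ hι hℓ' hχ hχ' hMB hMF hwin0 hwin1 in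
/-- **`δ_Q` AT THE TOWER IN THE COMPANION SHAPE**: `‖exp(κ•M_F)(Q_k(U)(exp(κ•(−M_B))f)) − exp(κ•M_F)(Q_k(V)(exp(κ•(−M_B))f))‖ ≤ M_φ′M_φ·√(c₁∕(c₀L^{(n+1)d}))·
P′_{n+1}·(T̃_{n+1} − 1)·‖f‖` with the readings `r_0 = 3ℓ′ + L^{n+1}ι`, `r_j = 2dL^{n+1−j}ι` substituted for `ℓ′_j` — the sibling's `norm_conj_QkW_sub_conj_QkW_le` at
the family `χ_0 := χ′`, `χ_j := χ ∘ up_j` (gen 94's geometry). [cite: Balaban1985BackgroundPropagators, (3.15)–(3.19) p.393, (3.49) p.399, (3.101) p.414] -/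
theorem norm_expConj_QkW_sub_expConj_QkW_le (f : BondL2K ℂ d (towerP L m (n + 1)) c₀ W) :
    ‖exp (κ • MF) (QkW L m n φ U hL α hα1 hU1 hreg (c₀ := c₀) (c₁ := c₁) (exp (κ • (-MB)) f)) -
        exp (κ • MF) (QkW L m n φ V hL α' hα1' hV1 hregV (c₀ := c₀) (c₁ := c₁) (exp (κ • (-MB)) f))‖ ≤
      Mφ' * Mφ * Real.sqrt (c₁ / (c₀ * ((L : ℝ) ^ (n + 1)) ^ d)) *
        ((∏ j ∈ Finset.range (n + 1), (1 + Real.sqrt ((L : ℝ) ^ d) * (Real.sqrt (2 * d) * (102 * (d + 1) ^ 2 * L * εU j) +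
            2 * (‖κ‖ * (if j = 0 then 3 * ℓ' + (L : ℝ) ^ (n + 1) * ι else 2 * d * (L : ℝ) ^ (n + 1 - j) * ι)) *
              Real.sqrt (2 * (2 * d * (102 * (d + 1) ^ 2 * L * εU j) ^ 2 + ((L : ℝ) ^ d)⁻¹))))) *
          ((∏ j ∈ Finset.range (n + 1), (1 + Real.sqrt ((L : ℝ) ^ d) *
              ((1 + 2 * (‖κ‖ * (if j = 0 then 3 * ℓ' + (L : ℝ) ^ (n + 1) * ι else 2 * d * (L : ℝ) ^ (n + 1 - j) * ι))) * (2 * d) *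
                (75497472 * ((d : ℝ) + 1) * ((2 * (d * L) + L + L : ℕ) : ℝ) * δUV j)))) - 1)) * ‖f‖ := by
  obtain ⟨up, hup⟩ := exists_levelEmbedding L m hL hm n
  have htop : ∀ z : TSite d (towerP L m (n + 1)), up (n + 1) z = z := fun z => by
    funext i; apply Fin.ext; rw [hup (n + 1) le_rfl, Nat.sub_self, pow_zero, one_mul]
  have hSinv : ∀ (g : BondL2K ℂ d (towerP L m (n + 1)) c₀ W) (b : Bond d (towerP L m (n + 1))),
      WL2.equiv ℂ (fun _ : Bond d (towerP L m (n + 1)) => c₀) W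
          ((((exp (κ • (-MB)) : BondL2K ℂ d (towerP L m (n + 1)) c₀ W →L[ℂ] BondL2K ℂ d (towerP L m (n + 1)) c₀ W) :
              BondL2K ℂ d (towerP L m (n + 1)) c₀ W →ₗ[ℂ] BondL2K ℂ d (towerP L m (n + 1)) c₀ W)) g) b =
        Complex.exp (-(κ * ((Nat.rec (motive := fun j => TSite d (towerP L m j) → ℝ) χ' (fun j _ z => χ (up (j + 1) z)) (n + 1)) b.1 : ℂ))) •
          WL2.equiv ℂ (fun _ : Bond d (towerP L m (n + 1)) => c₀) W g b := by
    intro g b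
    rw [ContinuousLinearMap.coe_coe, equiv_exp_smul_neg_apply_complex MB (fun b => χ (bpos b)) hMB κ g b]
    show Complex.exp (-(κ * (χ b.1 : ℂ))) • _ = Complex.exp (-(κ * (χ (up (n + 1) b.1) : ℂ))) • _
    rw [htop]
  have hSF : ∀ (g : BondL2K ℂ d m c₁ W) (c : Bond d m),
      WL2.equiv ℂ (fun _ : Bond d m => c₁) W
          ((((exp (κ • MF) : BondL2K ℂ d m c₁ W →L[ℂ] BondL2K ℂ d m c₁ W) : BondL2K ℂ d m c₁ W →ₗ[ℂ] BondL2K ℂ d m c₁ W)) g) c =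
        Complex.exp (κ * ((Nat.rec (motive := fun j => TSite d (towerP L m j) → ℝ) χ' (fun j _ z => χ (up (j + 1) z)) 0) c.1 : ℂ)) •
          WL2.equiv ℂ (fun _ : Bond d m => c₁) W g c := fun g c => by
    rw [ContinuousLinearMap.coe_coe, equiv_exp_smul_apply_complex MF (fun c => χ' (bpos c)) hMF κ g c]
    rfl
  have h := norm_conj_QkW_sub_conj_QkW_le L m n hL φ hMφ hMφ' hφ hφ' (c₀ := c₀) (c₁ := c₁) U V α hα1 hU1 hreg α' hα1' hV1 hregV hα128 εU hεU hUε hVε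
    δUV hδUV hδmax hUVδ
    (Nat.rec (motive := fun j => TSite d (towerP L m j) → ℝ) χ' (fun j _ z => χ (up (j + 1) z)))
    (fun j => if j = 0 then 3 * ℓ' + (L : ℝ) ^ (n + 1) * ι else 2 * d * (L : ℝ) ^ (n + 1 - j) * ι)
    (readings_nonneg L n hι hℓ') (family_readings L m n hL hm hι hℓ' hχ hχ' hup) (readings_window L n hL hι hwin0 hwin1) hSinv hSF f
  simpa only [ContinuousLinearMap.coe_coe] using h

include hL hm hMφ hMφ' hφ hφ' hα128 hεU hUε hVε hδUV hδmax hUVδ hι hℓ' hχ hχ' hMB hMF hwin0 hwin1 in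
/-- **`δ_Q′` AT THE TOWER IN THE COMPANION SHAPE**: `‖exp(κ•M_B)(Q_k(U)†(exp(κ•(−M_F))g)) − exp(κ•M_B)(Q_k(V)†(exp(κ•(−M_F))g))‖ ≤` the same constant `× ‖g‖` —
the sibling's `norm_conj_adjoint_QkW_sub_conj_adjoint_QkW_le` at the family `χ_0 := χ′`, `χ_j := χ ∘ up_j`.
[cite: Balaban1985BackgroundPropagators, (3.15)–(3.16) p.393, (3.26) p.395, (3.49) p.399] -/
theorem norm_expConj_adjoint_QkW_sub_expConj_adjoint_QkW_le (g : BondL2K ℂ d m c₁ W) :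
    ‖exp (κ • MB) (LinearMap.adjoint (QkW L m n φ U hL α hα1 hU1 hreg (c₀ := c₀) (c₁ := c₁)) (exp (κ • (-MF)) g)) -
        exp (κ • MB) (LinearMap.adjoint (QkW L m n φ V hL α' hα1' hV1 hregV (c₀ := c₀) (c₁ := c₁)) (exp (κ • (-MF)) g))‖ ≤
      Mφ' * Mφ * Real.sqrt (c₁ / (c₀ * ((L : ℝ) ^ (n + 1)) ^ d)) *
        ((∏ j ∈ Finset.range (n + 1), (1 + Real.sqrt ((L : ℝ) ^ d) * (Real.sqrt (2 * d) * (102 * (d + 1) ^ 2 * L * εU j) +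
            2 * (‖κ‖ * (if j = 0 then 3 * ℓ' + (L : ℝ) ^ (n + 1) * ι else 2 * d * (L : ℝ) ^ (n + 1 - j) * ι)) *
              Real.sqrt (2 * (2 * d * (102 * (d + 1) ^ 2 * L * εU j) ^ 2 + ((L : ℝ) ^ d)⁻¹))))) *
          ((∏ j ∈ Finset.range (n + 1), (1 + Real.sqrt ((L : ℝ) ^ d) *
              ((1 + 2 * (‖κ‖ * (if j = 0 then 3 * ℓ' + (L : ℝ) ^ (n + 1) * ι else 2 * d * (L : ℝ) ^ (n + 1 - j) * ι))) * (2 * d) *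
                (75497472 * ((d : ℝ) + 1) * ((2 * (d * L) + L + L : ℕ) : ℝ) * δUV j)))) - 1)) * ‖g‖ := by
  obtain ⟨up, hup⟩ := exists_levelEmbedding L m hL hm n
  have htop : ∀ z : TSite d (towerP L m (n + 1)), up (n + 1) z = z := fun z => by
    funext i; apply Fin.ext; rw [hup (n + 1) le_rfl, Nat.sub_self, pow_zero, one_mul]
  have hS : ∀ (f : BondL2K ℂ d (towerP L m (n + 1)) c₀ W) (b : Bond d (towerP L m (n + 1))),
      WL2.equiv ℂ (fun _ : Bond d (towerP L m (n + 1)) => c₀) W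
          ((((exp (κ • MB) : BondL2K ℂ d (towerP L m (n + 1)) c₀ W →L[ℂ] BondL2K ℂ d (towerP L m (n + 1)) c₀ W) :
              BondL2K ℂ d (towerP L m (n + 1)) c₀ W →ₗ[ℂ] BondL2K ℂ d (towerP L m (n + 1)) c₀ W)) f) b =
        Complex.exp (κ * ((Nat.rec (motive := fun j => TSite d (towerP L m j) → ℝ) χ' (fun j _ z => χ (up (j + 1) z)) (n + 1)) b.1 : ℂ)) •
          WL2.equiv ℂ (fun _ : Bond d (towerP L m (n + 1)) => c₀) W f b := by
    intro f b
    rw [ContinuousLinearMap.coe_coe, equiv_exp_smul_apply_complex MB (fun b => χ (bpos b)) hMB κ f b]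
    show Complex.exp (κ * (χ b.1 : ℂ)) • _ = Complex.exp (κ * (χ (up (n + 1) b.1) : ℂ)) • _
    rw [htop]
  have hSFinv : ∀ (g : BondL2K ℂ d m c₁ W) (c : Bond d m),
      WL2.equiv ℂ (fun _ : Bond d m => c₁) W
          ((((exp (κ • (-MF)) : BondL2K ℂ d m c₁ W →L[ℂ] BondL2K ℂ d m c₁ W) : BondL2K ℂ d m c₁ W →ₗ[ℂ] BondL2K ℂ d m c₁ W)) g) c =
        Complex.exp (-(κ * ((Nat.rec (motive := fun j => TSite d (towerP L m j) → ℝ) χ' (fun j _ z => χ (up (j + 1) z)) 0) c.1 : ℂ))) •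
          WL2.equiv ℂ (fun _ : Bond d m => c₁) W g c := fun g c => by
    rw [ContinuousLinearMap.coe_coe, equiv_exp_smul_neg_apply_complex MF (fun c => χ' (bpos c)) hMF κ g c]
    rfl
  have h := norm_conj_adjoint_QkW_sub_conj_adjoint_QkW_le L m n hL φ hMφ hMφ' hφ hφ' (c₀ := c₀) (c₁ := c₁) U V α hα1 hU1 hreg α' hα1' hV1 hregV
    hα128 εU hεU hUε hVε δUV hδUV hδmax hUVδ
    (Nat.rec (motive := fun j => TSite d (towerP L m j) → ℝ) χ' (fun j _ z => χ (up (j + 1) z)))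
    (fun j => if j = 0 then 3 * ℓ' + (L : ℝ) ^ (n + 1) * ι else 2 * d * (L : ℝ) ^ (n + 1 - j) * ι)
    (readings_nonneg L n hι hℓ') (family_readings L m n hL hm hι hℓ' hχ hχ' hup) (readings_window L n hL hι hwin0 hwin1) hS hSFinv g
  simpa only [LinearMap.comp_apply, ContinuousLinearMap.coe_coe] using h

end Letters

include hL hm hMφ hMφ' hφ hφ' hα128 hεU hUε hVε hδUV hδmax hUVδ hι hℓ' hχ hχ' hMB hMF in
/-- **THE TWO CONJUGATED TWO-BACKGROUND `Q_k` LETTERS ON THE CIRCLE `‖κ‖ = r`** (the `δ_Q` ∧ `δ_Q′` conjuncts of the consumer's `hT2'`, the windows and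
the constant read at `r`): `∀ κ, ‖κ‖ = r → (∀ f, ‖exp(κ•M_F)(Q_k(U)(exp(κ•(−M_B))f)) − exp(κ•M_F)(Q_k(V)(exp(κ•(−M_B))f))‖ ≤ δ_Q(r)·‖f‖) ∧ (∀ g, … ≤ δ_Q(r)·‖g‖)`.
[cite: Balaban1985BackgroundPropagators, (3.15)–(3.19) p.393, (3.26) p.395, (3.49) p.399, (3.101) p.414] -/
theorem expConj_Qk_letters_twoBackgrounds {r : ℝ} (hwin0 : r * (3 * ℓ' + (L : ℝ) ^ (n + 1) * ι) ≤ 1) (hwin1 : r * (2 * d * (L : ℝ) ^ n * ι) ≤ 1)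
    (κ : ℂ) (hκ : ‖κ‖ = r) :
    (∀ f : BondL2K ℂ d (towerP L m (n + 1)) c₀ W,
      ‖exp (κ • MF) (QkW L m n φ U hL α hα1 hU1 hreg (c₀ := c₀) (c₁ := c₁) (exp (κ • (-MB)) f)) -
          exp (κ • MF) (QkW L m n φ V hL α' hα1' hV1 hregV (c₀ := c₀) (c₁ := c₁) (exp (κ • (-MB)) f))‖ ≤
        Mφ' * Mφ * Real.sqrt (c₁ / (c₀ * ((L : ℝ) ^ (n + 1)) ^ d)) *
          ((∏ j ∈ Finset.range (n + 1), (1 + Real.sqrt ((L : ℝ) ^ d) * (Real.sqrt (2 * d) * (102 * (d + 1) ^ 2 * L * εU j) +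
              2 * (r * (if j = 0 then 3 * ℓ' + (L : ℝ) ^ (n + 1) * ι else 2 * d * (L : ℝ) ^ (n + 1 - j) * ι)) *
                Real.sqrt (2 * (2 * d * (102 * (d + 1) ^ 2 * L * εU j) ^ 2 + ((L : ℝ) ^ d)⁻¹))))) *
            ((∏ j ∈ Finset.range (n + 1), (1 + Real.sqrt ((L : ℝ) ^ d) *
                ((1 + 2 * (r * (if j = 0 then 3 * ℓ' + (L : ℝ) ^ (n + 1) * ι else 2 * d * (L : ℝ) ^ (n + 1 - j) * ι))) * (2 * d) *
                  (75497472 * ((d : ℝ) + 1) * ((2 * (d * L) + L + L : ℕ) : ℝ) * δUV j)))) - 1)) * ‖f‖) ∧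
    (∀ g : BondL2K ℂ d m c₁ W,
      ‖exp (κ • MB) (LinearMap.adjoint (QkW L m n φ U hL α hα1 hU1 hreg (c₀ := c₀) (c₁ := c₁)) (exp (κ • (-MF)) g)) -
          exp (κ • MB) (LinearMap.adjoint (QkW L m n φ V hL α' hα1' hV1 hregV (c₀ := c₀) (c₁ := c₁)) (exp (κ • (-MF)) g))‖ ≤
        Mφ' * Mφ * Real.sqrt (c₁ / (c₀ * ((L : ℝ) ^ (n + 1)) ^ d)) *
          ((∏ j ∈ Finset.range (n + 1), (1 + Real.sqrt ((L : ℝ) ^ d) * (Real.sqrt (2 * d) * (102 * (d + 1) ^ 2 * L * εU j) +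
              2 * (r * (if j = 0 then 3 * ℓ' + (L : ℝ) ^ (n + 1) * ι else 2 * d * (L : ℝ) ^ (n + 1 - j) * ι)) *
                Real.sqrt (2 * (2 * d * (102 * (d + 1) ^ 2 * L * εU j) ^ 2 + ((L : ℝ) ^ d)⁻¹))))) *
            ((∏ j ∈ Finset.range (n + 1), (1 + Real.sqrt ((L : ℝ) ^ d) *
                ((1 + 2 * (r * (if j = 0 then 3 * ℓ' + (L : ℝ) ^ (n + 1) * ι else 2 * d * (L : ℝ) ^ (n + 1 - j) * ι))) * (2 * d) *
                  (75497472 * ((d : ℝ) + 1) * ((2 * (d * L) + L + L : ℕ) : ℝ) * δUV j)))) - 1)) * ‖g‖) := by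
  subst hκ
  exact ⟨fun f => norm_expConj_QkW_sub_expConj_QkW_le L m n hL hm φ hMφ hMφ' hφ hφ' U V α hα1 hU1 hreg α' hα1' hV1 hregV hα128 εU hεU hUε hVε δUV
      hδUV hδmax hUVδ hι hℓ' hχ hχ' hMB hMF hwin0 hwin1 f,
    fun g => norm_expConj_adjoint_QkW_sub_expConj_adjoint_QkW_le L m n hL hm φ hMφ hMφ' hφ hφ' U V α hα1 hU1 hreg α' hα1' hV1 hregV hα128 εU hεU hUε
      hVε δUV hδUV hδmax hUVδ hι hℓ' hχ hχ' hMB hMF hwin0 hwin1 g⟩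

end Literature.MathematicalPhysics.QuantumFieldTheory.Balaban1983to89.B9Eq349ConjugatedQTowerLettersTwoBackgroundsCompanion

end
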